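import Mathlib.Analysis.SpecialFunctions.Complex.Arg
import Mathlib.Analysis.SpecialFunctions.Trigonometric.Inverse
import Mathlib.Analysis.SpecialFunctions.Log.Basic
import Literature.MathematicalPhysics.QuantumLattice.DWaveSource
import Literature.MathematicalPhysics.QuantumLattice.HubbardFermiRadius
import HarnessLib

/-!
# Sketch — crux-ideate stmt-HubbardSuperconductivity-1696 (TwSourcedInertness), ideator 3, round 1

First lemmas of the two idea cards (they must elaborate; proofs are not required at this stage):

* card `lee-yang-pair-source-cone`  — §C below;
* card `modular-sector-geometry`     — §B below.
-/

noncomputable section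

namespace Summit.HubbardSuperconductivity.HubbardSuperconductivity.Cruxes.TwSourcedInertness.Sketch

open Literature.MathematicalPhysics.QuantumLattice Matrix Complex

/-! ## §C  Lee–Yang in the complex pair source -/

section LeeYang

variable (L : ℕ) [NeZero L]

/-- The Hubbard torus with a COMPLEX `d`-wave pair source `h ∈ ℂ` (for real `h` this is
`dWaveSourceTorus L U μ h`). -/
def dWaveSourceTorusC (U μ : ℝ) (h : ℂ) :
    Matrix (Finset (Orb (FermionTorus 2 L))) (Finset (Orb (FermionTorus 2 L))) ℂ :=
  hubbardTorusWith 2 L 1 U μ - h • (pairField dWaveFormFactor L + (pairField dWaveFormFactor L)ᴴ)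

theorem dWaveSourceTorusC_ofReal (U μ h : ℝ) :
    dWaveSourceTorusC L U μ (h : ℂ) = dWaveSourceTorus L U μ h := rfl

/-- (C-max) **Maximum on the real axis.** For Hermitian `H`, `Q` and any complex source,
`|tr e^{-β(H - hQ)}| ≤ tr e^{-β(H - (Re h) Q)}` (Lie–Trotter + Hölder for Schatten norms: the
imaginary part of the source generates UNITARIES). First checkable statement of the line. -/
theorem norm_partitionFn_complexSource_le {n : Type*} [Fintype n] [DecidableEq n]
    (β : ℝ) (hβ : 0 ≤ β) {H Q : Matrix n n ℂ} (hH : H.IsHermitian) (hQ : Q.IsHermitian) (h : ℂ) :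
    ‖Matrix.partitionFn β (H - h • Q)‖ ≤ (Matrix.partitionFn β (H - ((h.re : ℝ) : ℂ) • Q)).re := by
  sorry

/-- (C-even) The sourced partition function is EVEN in the complex source (gauge rotation
`c ↦ i c` fixes `H`, flips `Δ + Δ†`). -/
theorem partitionFn_dWaveSourceTorusC_neg (β U μ : ℝ) (h : ℂ) :
    Matrix.partitionFn β (dWaveSourceTorusC L U μ (-h)) =
      Matrix.partitionFn β (dWaveSourceTorusC L U μ h) := by
  sorry

/-- (C-cone) **The cone lemma (GHS from Lee–Yang), per zero pair.** If a zero pair `±z` lies in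
the imaginary double cone `cos 2δ ≤ -cos(2 arg z)` (half-angle `δ < π/4` around `iℝ`), then for all
real `s`: `log |1 - s²/z²| ≤ (s²/cos 2δ) · Re(-1/z²)`, i.e. the pair's contribution to the sourced
pressure is dominated by its contribution to the LINEAR RESPONSE `χ(0)/2 = Σ Re(-1/z²)`. -/
theorem log_norm_one_sub_sq_div_sq_le_cone {z : ℂ} (hz : z ≠ 0) {δ : ℝ}
    (hδ : 0 < Real.cos (2 * δ)) (hcone : Real.cos (2 * δ) ≤ -Real.cos (2 * Complex.arg z)) (s : ℝ) :
    Real.log ‖1 - (s : ℂ) ^ 2 / z ^ 2‖ ≤ s ^ 2 / Real.cos (2 * δ) * (-(1 / z ^ 2)).re := by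
  sorry

/-- (C-any) Unconditional companion: ANY zero pair contributes at most `s²/|z|²`. -/
theorem log_norm_one_sub_sq_div_sq_le (z : ℂ) (hz : z ≠ 0) (s : ℝ) :
    Real.log ‖1 - (s : ℂ) ^ 2 / z ^ 2‖ ≤ s ^ 2 / ‖z‖ ^ 2 := by
  sorry

/-- The sourced pressure gain `F_L(s) = p̃_L(s) - p̃_L(0)` (the crux's left-hand side). -/
def sourcedGain (β U μ s : ℝ) : ℝ :=
  (Real.log (Matrix.partitionFn β (dWaveSourceTorus L U μ s)).re / (β * (L : ℝ) ^ 2)) -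
    (Real.log (Matrix.partitionFn β (dWaveSourceTorus L U μ 0)).re / (β * (L : ℝ) ^ 2))

/-- (C-reduction) **LOCAL + CONE + LIPSCHITZ ⇒ GLOBAL** (finite `L`, exact complex analysis:
Hadamard factorisation of the even, exponential-type `h ↦ Z_L(h)` in `h²`, Jensen with (C-max)).
If the crux's bound holds in SOME neighbourhood of `h = 0` with constant `K` (⇔ `χ_L(0) ≤ 2K`), the
zeros of `Z_L` in the disc `|h| ≤ r₀` lie in the imaginary cone of half-angle `δ < π/4`, and `F_L`
is `A`-Lipschitz, then the bound holds for ALL real sources with constant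
`K/cos 2δ + (4A/(r₀ log 2))(1 + 1/cos 2δ)`. -/
theorem sourcedGain_le_of_local_of_cone (β U μ : ℝ) (hβ : 0 < β) (K r₀ δ A : ℝ) (hr₀ : 0 < r₀)
    (hδ : 0 < Real.cos (2 * δ)) (hA : 0 ≤ A)
    (hloc : ∃ ε > 0, ∀ s : ℝ, |s| ≤ ε → sourcedGain L β U μ s ≤ K * s ^ 2)
    (hcone : ∀ h : ℂ, ‖h‖ ≤ r₀ → Matrix.partitionFn β (dWaveSourceTorusC L U μ h) = 0 →
      Real.cos (2 * δ) ≤ -Real.cos (2 * Complex.arg h))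
    (hLip : ∀ s : ℝ, sourcedGain L β U μ s ≤ A * |s|) :
    ∀ s : ℝ, sourcedGain L β U μ s ≤
      (K / Real.cos (2 * δ) + 4 * A / (r₀ * Real.log 2) * (1 + 1 / Real.cos (2 * δ))) * s ^ 2 := by
  sorry

end LeeYang

/-! ## §B  Modular sector geometry (umklapp is Cooper-disjoint) -/

section Modular

/-- (B-disjoint) **Umklapp quadruples never feed the Cooper channel.** On the level curve
`ε(k) = -2(cos k₁ + cos k₂) = μ`, `-4 < μ < 0`, inside the open square `(-π,π)²`, every coordinate
satisfies `|kᵢ| ≤ arccos(-μ/2 - 1) < π`; hence if four such momenta sum to a NON-ZERO reciprocal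
vector `2π n`, every pair sum is bounded away from `0` (in some coordinate) by `2(π - arccos(-μ/2-1))`. -/
theorem umklapp_cooper_disjoint (μ : ℝ) (hμ₁ : -4 < μ) (hμ₂ : μ < 0)
    (k : Fin 4 → Fin 2 → ℝ) (hk : ∀ j i, |k j i| < Real.pi)
    (hε : ∀ j, sqDispersion (k j) = μ) (n : Fin 2 → ℤ) (hn : n ≠ 0)
    (hsum : ∀ i, ∑ j, k j i = 2 * Real.pi * n i) (j j' : Fin 4) (hjj : j ≠ j') :
    ∃ i, 2 * (Real.pi - Real.arccos (-μ / 2 - 1)) ≤ |k j i + k j' i| := by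
  sorry

/-- (B-curv) **Uniform strict convexity at every filling below half filling.** The curvature
numerator of the level curve, `cos k₁ sin² k₂ + cos k₂ sin² k₁ = m(1 - cos k₁ cos k₂)` with
`m = -μ/2 ∈ (0,2)`, is bounded below by `m(1 - m²/4) > 0` on the whole curve. -/
theorem levelCurve_curvature_lower (μ : ℝ) (hμ₁ : -4 < μ) (hμ₂ : μ < 0) (k : Fin 2 → ℝ)
    (hε : sqDispersion k = μ) :
    (-μ / 2) * (1 - (-μ / 2) ^ 2 / 4) ≤
      Real.cos (k 0) * Real.sin (k 1) ^ 2 + Real.cos (k 1) * Real.sin (k 0) ^ 2 := by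
  sorry

/-- (B-radius) The polar Fermi radius exists and is unique for EVERY `-4 < μ < 0` (extends the
tree's `existsUnique_isFermiRadius`, stated for `μ < -2 - √2`, to all fillings below half filling:
the ray `t ↦ ε(t·dir θ)` is strictly increasing while it stays in `(-π,π)²`). -/
theorem existsUnique_fermiRadius_all (μ : ℝ) (hμ₁ : -4 < μ) (hμ₂ : μ < 0) (θ : ℝ) :
    ∃! t : ℝ, (0 < t ∧ ∀ i, |(t • dir θ) i| < Real.pi) ∧ sqDispersion (t • dir θ) = μ := by
  sorry

end Modular

end Summit.HubbardSuperconductivity.HubbardSuperconductivity.Cruxes.TwSourcedInertness.Sketch
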